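import Summits.BirchSwinnertonDyer.BirchSwinnertonDyer.Theorems.AdditiveBranchIMCGordTwoRankOneHeegnerKolyvaginHorizontal
import HarnessLib

/-!
# Route `AdditiveBranchIMC` (rung K1), crux `GordTwoRankOne` (item 19358): the Heegner–Kolyvagin road,
# Part 17c — `BSD(E,p)` (BOTH halves) on the ♯ rank-one rows of cell (G-ord, `e = 2`) from the sibling
# crux `KolyvaginPrimitiveAdditiveAbelianType` (Kolyvagin's conjecture mod `p`, item 20418), crux 19357's
# conclusion at the Heegner twists, and PUBLISHED facts — the sibling kernel's rank-zero residual
# `RankZeroAdditive` cut down to the LOWER half at the twists (cell `bsd-addord`, lane `bsd-addord-k1-c3x`,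
# gen 3; `--supports` only)

HONEST FRAMING. THEOREMS ONLY: no definition, no new named fact, no `sorry`; nothing is booked; cruxes
19357 / 19358 and the sibling items 20418 / 20136 stay OPEN; BSD is not proved by any of this.

WHY. Route `AdditiveKolyvaginRoad`'s landed kernel (`AdditiveKolyvaginKernel.additiveKolyvaginKernel_proof`)
gives `BSDp W p` on the ♯ rank-one additive rows at `p ≥ 5` from its crux `KolyvaginPrimitiveAdditive`, its
Manin-good frames, PUB, and its rank-ZERO residual `RankZeroAdditive` = `BSDp` for EVERY non-CM rank-zero
curve at EVERY additive `p ≥ 5` (used once: at the Heegner twist `E^{d_K}`). Part 17b showed that for the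
LOWER half of `E` that residual drops out (Kato 14.5 (3) gives the twist's `≤`-half). This file glues the
UPPER half back (lane B Part 6 `missingUpperBoundAt_rankOne_additive_of_twistLower`: Kolyvagin 1990 Thm. A
`ord_p #Ш(E/K) ≤ 2·ord_p[E(K):ℤy_K]` at a Manin-good frame + the twist's LOWER half) and records:
on the ♯ rows of (G-ord, `e = 2`) ∩ `r_an = 1` at `p ≥ 5`,
  `BSDp W p ⟸ KolyvaginPrimitiveAdditiveAbelianType ∧ ManinGoodOddFrameAdditive ∧ PUB ∧ [crux 19357's conclusion
  Typed.MissingLowerBoundAt Wd p at the Heegner-field twists of the row]`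
— the sibling's `RankZeroAdditive` replaced by exactly the K1 rank-zero crux's LOWER half at the twists
(`Wd` is again additive of type (G-ord, `e = 2`) at `p`: `d_K ∈ ℚ_p^{×2}`), at `p ≥ 11` with the Manin frame
PUBLISHED (Edixhoven, gen 0 Part 2). Compare lane B Part 11 (`…BSDp`): there the rank-one input was STEP L′ on
ALL tower-surjective rows; here it is the sibling crux on the ♯ rows.

References: [WZhang2014] Thm. 1.1, 10.2; [McCallumLMS1991] §1 (Kolyvagin's Thm. A), §5; [Kato2004Asterisque]
Thm. 14.5 (3); [JetchevSkinnerWan2017] §7.4.1–7.4.3; [EdixhovenManin1991] Thm. 3; [Miller2011LMS] Def. 1.1.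
-/

set_option autoImplicit false
set_option linter.dupNamespace false
noncomputable section
open scoped Classical NumberField
open WeierstrassCurve NumberField IsDedekindDomain Literature.NumberTheory.EllipticCurves
  Literature.NumberTheory.EllipticCurves.ModularForms Literature.NumberTheory.EllipticCurves.Rank1Residual
  Literature.NumberTheory.EllipticCurves.Rank1Residual.Typed Literature.NumberTheory.Automorphic
  Summit.BirchSwinnertonDyer.Rank1Residual Summit.BirchSwinnertonDyer.Rank1Residual.Additive
  Summit.BirchSwinnertonDyer.Rank1Residual.X11b Summit.BirchSwinnertonDyer.Rank1Residual.GaloisImage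
  Summit.BirchSwinnertonDyer.BirchSwinnertonDyer.Theses.AdditiveKolyvaginRoad
  Summit.BirchSwinnertonDyer.BirchSwinnertonDyer.Theorems.AdditiveKolyvaginKernel

namespace Summit.BirchSwinnertonDyer.BirchSwinnertonDyer.Theorems.AdditiveBranchIMCGordTwoRankOne.HeegnerKolyvagin

/-! ### §26 `BSD(E,p)` on the ♯ rows: sibling crux (rank one) + 19357 at the twists (rank zero) + PUB -/

/-- **`BSD(E,p)`, BOTH halves, at every ♯ pair of cell (G-ord, `e = 2`) ∩ `r_an = 1`, `p ≥ 5`** (`ρ̄_{E,p}`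
onto, ♠(1), ♠(2), `p ∤ ∏c(E)`), from: the sibling route's `PublishedInputsAdditiveKoly` (`hPub`), Manin-good
frames (`hM`, item 20136) and crux child `KolyvaginPrimitiveAdditiveAbelianType` (`hKA`, item 20418); Kato
14.5 (3) (`hKatoT`); and the rank-ZERO LOWER half `Typed.MissingLowerBoundAt Wd p` at every globally minimal
model `Wd` of a twist `E^{d_K}` by an imaginary quadratic Heegner field `K` of the conductor with
`L(E^{d_K},1) ≠ 0` (`hTwL`, crux 19357's conclusion at `(Wd, p)`; the binder shape of lane B Part 11).
LOWER(E) by Part 17b; UPPER(E) by Part 6 at the sibling's odd Hoffstein–Luo frame (`d_K < −4`, `p ∤ c`);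
glued by `Typed.missingPPartAt_of_lower_of_upper` / `Typed.bsdp_of_missingPPartAt`.
[cite: WZhang2014, Thm. 1.1 and Thm. 10.2] [cite: McCallumLMS1991, §1 Theorem (Kolyvagin), p. 296]
[cite: Kato2004Asterisque, Thm. 14.5 (3) (p. 236)] [cite: JetchevSkinnerWan2017, §7.4.1–7.4.3 (pp. 29–31)]
[cite: Miller2011LMS, §1 and Def. 1.1] -/
theorem cellGordTwo_bsdp_rankOne_sharp_of_kolyvaginPrimitiveAdditiveAbelianType_of_twistLower
    (hPub : PublishedInputsAdditiveKoly) (hM : ManinGoodOddFrameAdditive)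
    (hKA : KolyvaginPrimitiveAdditiveAbelianType)
    (hKatoT : Kato2004.rankZero_padicValNat_sha_add_padicValNat_tamagawa_le_of_additive_potGood_of_imageContainsSL2)
    (hTwL : ∀ (W : WeierstrassCurve ℚ) [W.IsElliptic] [W.IsGloballyMinimal] (p : ℕ) [Fact p.Prime]
      (K : Type) [Field K] [NumberField K]
      (Wd : WeierstrassCurve ℚ) [Wd.IsElliptic] [Wd.IsGloballyMinimal] (Cd : VariableChange ℚ),
      W.analyticRank = 1 → N10.CellGordTwo W p → (∀ n : ℕ, W.HasSurjectiveModNGaloisRep (p ^ n : ℕ)) →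
      IsImaginaryQuadratic K → SatisfiesHeegnerHypothesis (W.conductorNorm ℤ) K →
      (W.quadraticTwist (NumberField.discr K : ℚ)).entireLFunction 1 ≠ 0 →
      Cd • W.quadraticTwist (NumberField.discr K : ℚ) = Wd → Typed.MissingLowerBoundAt Wd p) :
    ∀ (W : WeierstrassCurve ℚ) [W.IsElliptic] [W.IsGloballyMinimal] (p : ℕ) [Fact p.Prime],
      W.analyticRank = 1 → N10.CellGordTwo W p → 5 ≤ p → W.HasSurjectiveModNGaloisRep p →
      (∀ (ℓ : ℕ) [Fact ℓ.Prime], W.HasMultiplicativeReductionAtPrime ℓ →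
        ¬ p ∣ padicValInt ℓ W.minimalDiscriminantInt) →
      (∃ (ℓ₁ ℓ₂ : ℕ) (_ : Fact ℓ₁.Prime) (_ : Fact ℓ₂.Prime), ℓ₁ ≠ ℓ₂ ∧
        W.HasMultiplicativeReductionAtPrime ℓ₁ ∧ W.HasMultiplicativeReductionAtPrime ℓ₂) →
      ¬ p ∣ W.tamagawaProduct → BSDp W p := by
  intro W _ _ p _ hr hc2 hp5 hsurjp hsp htwo htam
  haveI : NeZero (W.conductorNorm ℤ) := ⟨(W.conductorNorm_pos_holds).ne'⟩
  have hp : p.Prime := Fact.out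
  obtain ⟨hp2, hadd, hG⟩ : p ≠ 2 ∧ Addv W p ∧ TypeGOrd W p := ⟨hc2.1, hc2.2.1, hc2.2.2.1⟩
  -- LOWER(E,p): Part 17b
  have hlow : Typed.MissingLowerBoundAt W p :=
    cellGordTwo_missingLowerBoundAt_rankOne_sharp_of_kolyvaginPrimitiveAdditiveAbelianType hPub hM hKA hKatoT W p
      hr hc2 hp5 hsurjp hsp htwo htam
  -- UPPER(E,p): Part 6 at the sibling's odd Hoffstein–Luo frame
  have hirr : Irr W p := hasIrreducibleModPGaloisRep_of_hasSurjectiveModNGaloisRep W p hsurjp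
  have hsurj : ∀ m : ℕ, W.HasSurjectiveModNGaloisRep (p ^ m : ℕ) :=
    serre_hasSurjectiveModNGaloisRep_pow_holds W p hp5 hsurjp
  obtain ⟨K₀, _, _, Dt₀, -, -, -, -, -, -, -, -, -, -, -, -, hc₀, -, -, -⟩ := hM hPub W p hp5 hadd hirr hr
  obtain ⟨hGZ, hKo, hB, hGZK, hmod, hnf, hHL, -, -, -⟩ := hPub
  obtain ⟨K, _, _, Dt, H, ι, P, Wd, _, _, Cd, hK, -, -, -, hHN, hP, hc, hμ, hLt, hWd⟩ :=
    exists_oddHeegnerFrame_lt_of_exists_not_dvd hnf hHL W p hr hp2 ⟨Dt₀, hc₀⟩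
  have hup : Typed.MissingUpperBoundAt W p :=
    missingUpperBoundAt_rankOne_additive_of_twistLower W p K Dt H ι P (hGZ _ W K) (hKo _ W K) (hB _ W K)
      hGZK hmod hr hp5 hsurjp htam hK hHN hP hc hμ hLt Wd Cd hWd hadd.1
      (hTwL W p K Wd Cd hr hc2 hsurj hK hHN hLt hWd)
  exact Typed.bsdp_of_missingPPartAt W p hGZK (le_of_eq hr) (Typed.missingPPartAt_of_lower_of_upper W p hlow hup)

/-- **The same at `p ≥ 11` with the Manin frame PUBLISHED** (Edixhoven 1991 Thm. 3 via lane B Part 2): on the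
♯ rows of (G-ord, `e = 2`) ∩ `r_an = 1` at `p ≥ 11`, `BSDp W p ⟸ KolyvaginPrimitiveAdditiveAbelianType ∧ PUB ∧
[crux 19357's conclusion at the Heegner-field twists]` — two OPEN binders, both registered items' conclusions
(20418, 19357), nothing else. [cite: EdixhovenManin1991, Thm. 3] [cite: WZhang2014, Thm. 1.1 and Thm. 10.2]
[cite: McCallumLMS1991, §1 Theorem (Kolyvagin), p. 296] [cite: Kato2004Asterisque, Thm. 14.5 (3) (p. 236)]
[cite: Miller2011LMS, §1 and Def. 1.1] -/
theorem cellGordTwo_bsdp_rankOne_sharp_eleven_of_kolyvaginPrimitiveAdditiveAbelianType_of_twistLower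
    (hPub : PublishedInputsAdditiveKoly) (hKA : KolyvaginPrimitiveAdditiveAbelianType)
    (hKatoT : Kato2004.rankZero_padicValNat_sha_add_padicValNat_tamagawa_le_of_additive_potGood_of_imageContainsSL2)
    (hmodP : nonempty_modularParametrizationData)
    (hEdxK : edixhoven_not_dvd_maninConstant_of_kodairaSymbol_ne)
    (hNS : integral_neronScaling_of_isGloballyMinimal)
    (hTwL : ∀ (W : WeierstrassCurve ℚ) [W.IsElliptic] [W.IsGloballyMinimal] (p : ℕ) [Fact p.Prime]
      (K : Type) [Field K] [NumberField K]
      (Wd : WeierstrassCurve ℚ) [Wd.IsElliptic] [Wd.IsGloballyMinimal] (Cd : VariableChange ℚ),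
      W.analyticRank = 1 → N10.CellGordTwo W p → (∀ n : ℕ, W.HasSurjectiveModNGaloisRep (p ^ n : ℕ)) →
      IsImaginaryQuadratic K → SatisfiesHeegnerHypothesis (W.conductorNorm ℤ) K →
      (W.quadraticTwist (NumberField.discr K : ℚ)).entireLFunction 1 ≠ 0 →
      Cd • W.quadraticTwist (NumberField.discr K : ℚ) = Wd → Typed.MissingLowerBoundAt Wd p) :
    ∀ (W : WeierstrassCurve ℚ) [W.IsElliptic] [W.IsGloballyMinimal] (p : ℕ) [Fact p.Prime],
      W.analyticRank = 1 → N10.CellGordTwo W p → 11 ≤ p → W.HasSurjectiveModNGaloisRep p →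
      (∀ (ℓ : ℕ) [Fact ℓ.Prime], W.HasMultiplicativeReductionAtPrime ℓ →
        ¬ p ∣ padicValInt ℓ W.minimalDiscriminantInt) →
      (∃ (ℓ₁ ℓ₂ : ℕ) (_ : Fact ℓ₁.Prime) (_ : Fact ℓ₂.Prime), ℓ₁ ≠ ℓ₂ ∧
        W.HasMultiplicativeReductionAtPrime ℓ₁ ∧ W.HasMultiplicativeReductionAtPrime ℓ₂) →
      ¬ p ∣ W.tamagawaProduct → BSDp W p := by
  intro W _ _ p _ hr hc2 hp11 hsurjp hsp htwo htam
  haveI : NeZero (W.conductorNorm ℤ) := ⟨(W.conductorNorm_pos_holds).ne'⟩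
  have hp : p.Prime := Fact.out
  obtain ⟨hp2, hadd, hG⟩ : p ≠ 2 ∧ Addv W p ∧ TypeGOrd W p := ⟨hc2.1, hc2.2.1, hc2.2.2.1⟩
  have hp5 : 5 ≤ p := by omega
  have hlow : Typed.MissingLowerBoundAt W p :=
    cellGordTwo_missingLowerBoundAt_rankOne_sharp_eleven_of_kolyvaginPrimitiveAdditiveAbelianType hPub hKA hKatoT
      hmodP hEdxK hNS W p hr hc2 hp11 hsurjp hsp htwo htam
  obtain ⟨hGZ, hKo, hB, hGZK, hmod, hnf, hHL, -, -, -⟩ := hPub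
  have hirr : Irr W p := hasIrreducibleModPGaloisRep_of_hasSurjectiveModNGaloisRep W p hsurjp
  have hsurj : ∀ m : ℕ, W.HasSurjectiveModNGaloisRep (p ^ m : ℕ) :=
    serre_hasSurjectiveModNGaloisRep_pow_holds W p hp5 hsurjp
  have hD : ∃ Dt : ModularParametrizationData W (W.conductorNorm ℤ), ¬ (p : ℤ) ∣ Dt.c :=
    exists_modularParametrizationData_not_dvd_of_cellGordTwo hnf hmodP hEdxK hNS W p hc2 (by omega) hirr
  obtain ⟨K, _, _, Dt, H, ι, P, Wd, _, _, Cd, hK, -, -, -, hHN, hP, hc, hμ, hLt, hWd⟩ :=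
    exists_oddHeegnerFrame_lt_of_exists_not_dvd hnf hHL W p hr hp2 hD
  have hup : Typed.MissingUpperBoundAt W p :=
    missingUpperBoundAt_rankOne_additive_of_twistLower W p K Dt H ι P (hGZ _ W K) (hKo _ W K) (hB _ W K)
      hGZK hmod hr hp5 hsurjp htam hK hHN hP hc hμ hLt Wd Cd hWd hadd.1
      (hTwL W p K Wd Cd hr hc2 hsurj hK hHN hLt hWd)
  exact Typed.bsdp_of_missingPPartAt W p hGZK (le_of_eq hr) (Typed.missingPPartAt_of_lower_of_upper W p hlow hup)

end Summit.BirchSwinnertonDyer.BirchSwinnertonDyer.Theorems.AdditiveBranchIMCGordTwoRankOne.HeegnerKolyvagin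

end
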